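import Summits.AtomisticToContinuum.BoseEinsteinCondensation.Theorems.BECConjugateDominationHardCoreExtensionTowerEnergyConvergence
import HarnessLib

/-!
# Rellich limit of near-minimisers along a monotone tower of minorants: stub `stub_towerNearMinLimit`
# (S-A) of line `near-minimiser-slack-transfer`, crux `BECConjugateDomination.HardCoreExtension`
# (stmt-AtomisticToContinuum-11786)

Fix `(N, L)` with `L > 0`, a repulsive finite-range `v` with `E₀(v) < ⊤`, a tower of measurable profiles
`w₀ ≤ w₁ ≤ … ↑ v` (pointwise), a finite slack `δ`, levels `k j → ∞` and a GIVEN sequence `Ψ j` of periodic trial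
states that are `δ`-near-minimisers of the tower members `w (k j)`. Then a subsequence of the embedded classes
`ι(graphEmbed (Ψ j)) ∈ L²((ℝ/ℤ)^{3N})` (free form domain of `PeriodicFormDomain.lean`; Rellich =
`isCompactOperator_formEmbed`) converges in `L²` to a unit vector `η`, Bose-symmetric in momentum space, whose
MAXIMAL-form `v`-energy is at most `E₀(v) + δ`:

* kinetic part: lower semicontinuity of weighted Fourier sums (`tsum_mul_inner_sq_le_liminf`);
* potential part of a FIXED lower level `w m`: Fatou along an a.e.-convergent further subsequence, then
  `E_{w m}(Ψ j) ≤ E_{w (k j)}(Ψ j) ≤ E₀(w (k j)) + δ ≤ E₀(v) + δ` for `k j ≥ m` (monotonicity in the profile);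
* `m → ∞` by Beppo Levi (`⨆ₘ W_{w m} = W_v` pointwise).

This is `exists_limitProfile_family` (`…BECGroundStateSOSPeriodicIRBoundPFTruncFamily.lean`) run on the given
sequence instead of self-chosen `1/(n+1)`-near-minimisers, with the convergent subsequence exposed.

References: [ReedSimonIV1978] Thm. XIII.64; B. Simon, J. Funct. Anal. 28 (1978) 377–385.
-/

noncomputable section

namespace Summit.AtomisticToContinuum.BoseEinsteinCondensation.Cruxes.HardCoreExtension.NearMinTower

open MeasureTheory Filter
open scoped ENNReal NNReal Topology
open Literature.MathematicalPhysics.QuantumManyBody.BoseGas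
open UnitAddTorus
open Summit.AtomisticToContinuum.BoseEinsteinCondensation.Cruxes.StaticResponseBound.UvThomsonForceWave
  (measurable_zeroProfile lintegral_periodicInteraction_zero_ne_top)

attribute [local instance] Literature.MathematicalPhysics.QuantumManyBody.BoseGas.formDomain_measureSpace
  Literature.MathematicalPhysics.QuantumManyBody.BoseGas.formDomain_isProbabilityMeasure
  Literature.MathematicalPhysics.QuantumManyBody.BoseGas.formDomain_isProbabilityMeasure_pi

open scoped InnerProductSpace

section LimitOfNearMinimisers

open Summit.AtomisticToContinuum.BoseEinsteinCondensation.Cruxes.StaticResponseBound.UvThomsonForceWave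
open Summit.AtomisticToContinuum.BoseEinsteinCondensation.Cruxes.PeriodicIRBound.LinearPhFloorWagner

variable {N : ℕ} {L : ℝ} {v : ℝ → ℝ≥0∞} {w : ℕ → ℝ → ℝ≥0∞}

/-- **Rellich limit of a given sequence of near-minimisers along an increasing family** (Rellich + lower
semicontinuity + Fatou + Beppo Levi, the proof of `exists_limitProfile_family` run on a GIVEN sequence): for
measurable profiles `w₀ ≤ w₁ ≤ … ↑ v` pointwise, levels `k j → ∞` and trial states `Ψ j` with
`E_{w (k j)}(Ψ j) ≤ E` (`E < ⊤`), a subsequence of the embedded classes `ι(graphEmbed (Ψ j))` converges in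
`L²((ℝ/ℤ)^{3N})` to a unit Bose-symmetric `η` of maximal-form `v`-energy `≤ E`. [cite: ReedSimonIV1978, Thm. XIII.64] -/
theorem exists_limitProfile_of_energy_le (hwm : ∀ n, Measurable (w n)) (hmono : ∀ r, Monotone fun n => w n r)
    (hsup : ∀ r, ⨆ n, w n r = v r) (hL : 0 < L) {E : ℝ≥0∞} (hE : E ≠ ⊤) {k : ℕ → ℕ}
    (hk : Tendsto k atTop atTop) (Ψ : ℕ → PeriodicTrialState N L)
    (hΨ : ∀ j, periodicEnergy (w (k j)) (Ψ j) ≤ E) :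
    ∃ η : Lp ℂ 2 (volume : Measure (UnitAddTorus (Fin N × Fin 3))), ‖η‖ = 1 ∧
      (∀ (σ : Equiv.Perm (Fin N)) (n : Fin N × Fin 3 → ℤ),
        ⟪(mFourierLp 2 (fun p : Fin N × Fin 3 => n (σ p.1, p.2)) :
            Lp ℂ 2 (volume : Measure (UnitAddTorus (Fin N × Fin 3)))), η⟫_ℂ =
          ⟪(mFourierLp 2 n : Lp ℂ 2 (volume : Measure (UnitAddTorus (Fin N × Fin 3)))), η⟫_ℂ) ∧
      (∑' n : Fin N × Fin 3 → ℤ, ENNReal.ofReal (∑ p, (2 * Real.pi * (n p : ℝ) / L) ^ 2) *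
          (‖⟪(mFourierLp 2 n : Lp ℂ 2 (volume : Measure (UnitAddTorus (Fin N × Fin 3)))), η⟫_ℂ‖₊ :
            ℝ≥0∞) ^ 2 +
        ∫⁻ t, periodicInteraction v L (fromUnitTorusN L t) *
          (‖(η : UnitAddTorus (Fin N × Fin 3) → ℂ) t‖₊ : ℝ≥0∞) ^ 2 ≤ E) ∧
      ∃ φ : ℕ → ℕ, StrictMono φ ∧
        Tendsto (fun j => formEmbed hL measurable_zeroProfile (lintegral_periodicInteraction_zero_ne_top N L)
          ⟨graphEmbed hL measurable_zeroProfile (lintegral_periodicInteraction_zero_ne_top N L)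
            ⟨(Ψ (φ j)).ψ, (Ψ (φ j)).mem_periodicCore⟩,
            graphEmbed_mem_formDomain hL measurable_zeroProfile
              (lintegral_periodicInteraction_zero_ne_top N L) _⟩) atTop (𝓝 η) := by
  -- the FREE form domain as a compactness device
  set g : ℕ → formDomain hL measurable_zeroProfile (lintegral_periodicInteraction_zero_ne_top N L) :=
    fun n => ⟨graphEmbed hL measurable_zeroProfile (lintegral_periodicInteraction_zero_ne_top N L)
      ⟨(Ψ n).ψ, (Ψ n).mem_periodicCore⟩, graphEmbed_mem_formDomain _ _ _ _⟩ with hg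
  set f : ℕ → Lp ℂ 2 (volume : Measure (UnitAddTorus (Fin N × Fin 3))) := fun n =>
    formEmbed hL measurable_zeroProfile (lintegral_periodicInteraction_zero_ne_top N L) (g n) with hf
  have hf1 : ∀ n, ‖f n‖ = 1 := fun n =>
    norm_formEmbed_graphEmbed_trialState hL measurable_zeroProfile
      (lintegral_periodicInteraction_zero_ne_top N L) (Ψ n)
  have hkin_le : ∀ n, ∫⁻ X in cellN N L, kineticDensity (Ψ n).ψ X ≤ E := fun n =>
    (lintegral_kineticDensity_le_periodicEnergy _ (Ψ n)).trans (hΨ n)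
  have hgn : ∀ n, ‖g n‖ ^ 2 ≤ 1 + E.toReal := fun n => by
    have h1 : ‖g n‖ = ‖graphEmbed hL measurable_zeroProfile (lintegral_periodicInteraction_zero_ne_top N L)
        ⟨(Ψ n).ψ, (Ψ n).mem_periodicCore⟩‖ := rfl
    rw [h1, norm_graphEmbed_sq_trialState, periodicEnergy_zero_eq]
    have h2 : (∫⁻ X in cellN N L, kineticDensity (Ψ n).ψ X).toReal ≤ E.toReal :=
      ENNReal.toReal_mono hE (hkin_le n)
    linarith
  -- Rellich: an `L²`-convergent subsequence of the embedded near-minimisers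
  set R : ℝ := Real.sqrt (1 + E.toReal) + 1 with hR
  have hball : ∀ n, g n ∈ Metric.ball (0 : formDomain hL measurable_zeroProfile
      (lintegral_periodicInteraction_zero_ne_top N L)) R := fun n => by
    rw [Metric.mem_ball, dist_zero_right]
    have h := Real.abs_le_sqrt (hgn n)
    rw [abs_of_nonneg (norm_nonneg _)] at h
    linarith
  have hK : IsCompact (closure ((formEmbed hL measurable_zeroProfile
      (lintegral_periodicInteraction_zero_ne_top N L)) '' Metric.ball 0 R)) :=
    (isCompactOperator_formEmbed hL measurable_zeroProfile
      (lintegral_periodicInteraction_zero_ne_top N L)).isCompact_closure_image_ball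
      (f := (formEmbed hL measurable_zeroProfile (lintegral_periodicInteraction_zero_ne_top N L) :
        formDomain hL measurable_zeroProfile (lintegral_periodicInteraction_zero_ne_top N L) →ₗ[ℂ]
          Lp ℂ 2 (volume : Measure (UnitAddTorus (Fin N × Fin 3))))) R
  obtain ⟨η, -, φ, hφ, hconv⟩ := hK.tendsto_subseq (x := f) fun n => subset_closure ⟨g n, hball n, rfl⟩
  -- an a.e.-convergent further subsequence
  obtain ⟨ns, hns, hae⟩ := (tendstoInMeasure_of_tendsto_Lp hconv).exists_seq_tendsto_ae
  set ψ : ℕ → ℕ := φ ∘ ns with hψdef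
  have hψ : StrictMono ψ := hφ.comp hns
  have hconvψ : Tendsto (fun i => f (ψ i)) atTop (𝓝 η) := hconv.comp hns.tendsto_atTop
  have haeψ : ∀ᵐ t ∂(volume : Measure (UnitAddTorus (Fin N × Fin 3))),
      Tendsto (fun i => (f (ψ i) : UnitAddTorus (Fin N × Fin 3) → ℂ) t) atTop
        (𝓝 ((η : UnitAddTorus (Fin N × Fin 3) → ℂ) t)) := hae
  refine ⟨η, ?_, ?_, ?_, ψ, hψ, hconvψ⟩
  · -- `‖η‖ = 1`
    have h1 : Tendsto (fun i => ‖f (ψ i)‖) atTop (𝓝 ‖η‖) := (continuous_norm.tendsto η).comp hconvψ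
    simp only [hf1] at h1
    exact tendsto_nhds_unique h1 tendsto_const_nhds
  · -- Bose symmetry in momentum space passes to the limit
    intro σ n
    have hc : ∀ m : Fin N × Fin 3 → ℤ, Continuous fun x : Lp ℂ 2 (volume : Measure (UnitAddTorus (Fin N × Fin 3))) =>
        ⟪(mFourierLp 2 m : Lp ℂ 2 (volume : Measure (UnitAddTorus (Fin N × Fin 3)))), x⟫_ℂ :=
      fun m => continuous_const.inner continuous_id
    have h1 := ((hc (fun p : Fin N × Fin 3 => n (σ p.1, p.2))).tendsto η).comp hconvψ
    have h2 := ((hc n).tendsto η).comp hconvψ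
    have h12 : (fun x : Lp ℂ 2 (volume : Measure (UnitAddTorus (Fin N × Fin 3))) =>
        ⟪(mFourierLp 2 (fun p : Fin N × Fin 3 => n (σ p.1, p.2)) :
          Lp ℂ 2 (volume : Measure (UnitAddTorus (Fin N × Fin 3)))), x⟫_ℂ) ∘ (fun i => f (ψ i)) =
        (fun x : Lp ℂ 2 (volume : Measure (UnitAddTorus (Fin N × Fin 3))) =>
          ⟪(mFourierLp 2 n : Lp ℂ 2 (volume : Measure (UnitAddTorus (Fin N × Fin 3)))), x⟫_ℂ) ∘
            (fun i => f (ψ i)) := by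
      funext i
      simp only [Function.comp_apply, hf]
      rw [inner_mFourierLp_formEmbed_trialState, inner_mFourierLp_formEmbed_trialState,
        configFourierCoeff_perm (Ψ (ψ i)).symm]
    rw [h12] at h1
    exact tendsto_nhds_unique h1 h2
  · -- the energy bound, first at each member `m` of the family
    have hm : ∀ m : ℕ,
        ∑' n : Fin N × Fin 3 → ℤ, ENNReal.ofReal (∑ p, (2 * Real.pi * (n p : ℝ) / L) ^ 2) *
            (‖⟪(mFourierLp 2 n : Lp ℂ 2 (volume : Measure (UnitAddTorus (Fin N × Fin 3)))), η⟫_ℂ‖₊ :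
              ℝ≥0∞) ^ 2 +
          ∫⁻ t, periodicInteraction (w m) L (fromUnitTorusN L t) *
            (‖(η : UnitAddTorus (Fin N × Fin 3) → ℂ) t‖₊ : ℝ≥0∞) ^ 2 ≤ E := by
      intro m
      have hWm : Measurable (periodicInteraction (N := N) (w m) L) := measurable_periodicInteraction_trunc (hwm m) L
      -- lower semicontinuity of the kinetic energy
      have hkin : ∑' n : Fin N × Fin 3 → ℤ, ENNReal.ofReal (∑ p, (2 * Real.pi * (n p : ℝ) / L) ^ 2) *
            (‖⟪(mFourierLp 2 n : Lp ℂ 2 (volume : Measure (UnitAddTorus (Fin N × Fin 3)))), η⟫_ℂ‖₊ :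
              ℝ≥0∞) ^ 2 ≤
          liminf (fun i => ∫⁻ X in cellN N L, kineticDensity (Ψ (ψ i)).ψ X) atTop := by
        have h := tsum_mul_inner_sq_le_liminf
          (fun n : Fin N × Fin 3 → ℤ => (mFourierLp 2 n : Lp ℂ 2 (volume : Measure (UnitAddTorus (Fin N × Fin 3)))))
          (w := fun n : Fin N × Fin 3 → ℤ => ENNReal.ofReal (∑ p, (2 * Real.pi * (n p : ℝ) / L) ^ 2))
          (fun _ => ENNReal.ofReal_ne_top) hconvψ
        refine h.trans_eq ?_
        congr 1
        funext i
        exact tsum_kinetic_formEmbed_trialState hL (Ψ (ψ i))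
      -- Fatou for the potential energy of the member `m`
      have hpot : ∫⁻ t, periodicInteraction (w m) L (fromUnitTorusN L t) *
            (‖(η : UnitAddTorus (Fin N × Fin 3) → ℂ) t‖₊ : ℝ≥0∞) ^ 2 ≤
          liminf (fun i => ∫⁻ X in cellN N L, periodicInteraction (w m) L X *
            (‖(Ψ (ψ i)).ψ X‖₊ : ℝ≥0∞) ^ 2) atTop := by
        calc ∫⁻ t, periodicInteraction (w m) L (fromUnitTorusN L t) *
              (‖(η : UnitAddTorus (Fin N × Fin 3) → ℂ) t‖₊ : ℝ≥0∞) ^ 2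
            ≤ ∫⁻ t, liminf (fun i => periodicInteraction (w m) L (fromUnitTorusN L t) *
                (‖(f (ψ i) : UnitAddTorus (Fin N × Fin 3) → ℂ) t‖₊ : ℝ≥0∞) ^ 2) atTop := by
              refine lintegral_mono_ae (haeψ.mono fun t ht => ?_)
              have hsq : Tendsto (fun i => (‖(f (ψ i) : UnitAddTorus (Fin N × Fin 3) → ℂ) t‖₊ : ℝ≥0∞) ^ 2)
                  atTop (𝓝 ((‖(η : UnitAddTorus (Fin N × Fin 3) → ℂ) t‖₊ : ℝ≥0∞) ^ 2)) :=
                ((ENNReal.continuous_pow 2).tendsto _).comp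
                  ((ENNReal.continuous_coe.tendsto _).comp ht.nnnorm)
              rw [← hsq.liminf_eq]
              exact mul_liminf_le _ _
          _ ≤ liminf (fun i => ∫⁻ t, periodicInteraction (w m) L (fromUnitTorusN L t) *
                (‖(f (ψ i) : UnitAddTorus (Fin N × Fin 3) → ℂ) t‖₊ : ℝ≥0∞) ^ 2) atTop :=
              lintegral_liminf_le' fun i => ((hWm.comp (measurable_fromUnitTorusN L)).aemeasurable.mul
                ((Lp.aestronglyMeasurable (f (ψ i))).aemeasurable.nnnorm.coe_nnreal_ennreal.pow_const 2))
          _ = liminf (fun i => ∫⁻ X in cellN N L, periodicInteraction (w m) L X *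
                (‖(Ψ (ψ i)).ψ X‖₊ : ℝ≥0∞) ^ 2) atTop := by
              congr 1
              funext i
              exact lintegral_pot_formEmbed_trialState hL (Ψ (ψ i)) hWm
      -- combine and use the energy bound along `k (ψ i) ≥ m`
      set KINi : ℕ → ℝ≥0∞ := fun i => ∫⁻ X in cellN N L, kineticDensity (Ψ (ψ i)).ψ X with hKINi
      set POTi : ℕ → ℝ≥0∞ := fun i => ∫⁻ X in cellN N L, periodicInteraction (w m) L X *
          (‖(Ψ (ψ i)).ψ X‖₊ : ℝ≥0∞) ^ 2 with hPOTi
      have hsum : ∀ i, KINi i + POTi i = periodicEnergy (w m) (Ψ (ψ i)) := fun i => by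
        simp only [hKINi, hPOTi, periodicEnergy]
        rw [← lintegral_add_left (measurable_kineticDensity_any (Ψ (ψ i)).ψ)]
      have hev : ∀ᶠ i in atTop, KINi i + POTi i ≤ E := by
        filter_upwards [(hk.comp hψ.tendsto_atTop).eventually (eventually_ge_atTop m)] with i hi
        rw [hsum i]
        exact (monotone_periodicEnergy_family hmono (Ψ (ψ i)) hi).trans (hΨ (ψ i))
      calc _ ≤ liminf KINi atTop + liminf POTi atTop := add_le_add hkin hpot
        _ ≤ liminf (fun i => KINi i + POTi i) atTop := liminf_add_liminf_le KINi POTi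
        _ ≤ liminf (fun _ : ℕ => E) atTop := liminf_le_liminf hev
        _ = E := liminf_const E
    -- Beppo Levi along the family
    have hmeas_m : ∀ m, AEMeasurable (fun t => periodicInteraction (w m) L (fromUnitTorusN L t) *
        (‖(η : UnitAddTorus (Fin N × Fin 3) → ℂ) t‖₊ : ℝ≥0∞) ^ 2) volume := fun m =>
      ((measurable_periodicInteraction_trunc (hwm m) L).comp
        (measurable_fromUnitTorusN L)).aemeasurable.mul
        ((Lp.aestronglyMeasurable η).aemeasurable.nnnorm.coe_nnreal_ennreal.pow_const 2)
    have hsup' : ∫⁻ t, periodicInteraction v L (fromUnitTorusN L t) *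
          (‖(η : UnitAddTorus (Fin N × Fin 3) → ℂ) t‖₊ : ℝ≥0∞) ^ 2 =
        ⨆ m, ∫⁻ t, periodicInteraction (w m) L (fromUnitTorusN L t) *
          (‖(η : UnitAddTorus (Fin N × Fin 3) → ℂ) t‖₊ : ℝ≥0∞) ^ 2 := by
      rw [← lintegral_iSup' hmeas_m (Eventually.of_forall fun t => fun m m' h => by
        dsimp only
        gcongr
        exact monotone_periodicInteraction_family hmono L _ h)]
      refine lintegral_congr fun t => ?_
      rw [← ENNReal.iSup_mul, iSup_periodicInteraction_family hmono hsup]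
    rw [hsup', ENNReal.add_iSup]
    exact iSup_le hm

end LimitOfNearMinimisers

/-- Worker stub **S-A `stub_towerNearMinLimit`** (fixed volume; Rellich + lower semicontinuity + Fatou + Beppo Levi, the
landed `exists_limitProfile_family` run on a GIVEN sequence of level-`k j` near-minimisers with slack `δ`, exposing the
`L²`-convergent subsequence): a unit Bose-symmetric `η ∈ L²((ℝ/ℤ)^{3N})` with maximal `v`-form energy `≤ E₀(v) + δ` and a
subsequence of the embedded states converging to it (`exists_limitProfile_of_energy_le` with
`E_{w (k j)}(Ψ j) ≤ E₀(w (k j)) + δ ≤ E₀(v) + δ`). [cite: ReedSimonIV1978, Thm. XIII.64] -/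
theorem stub_towerNearMinLimit :
    ∀ v : ℝ → ℝ≥0∞, IsRepulsiveFiniteRange v → ∀ w : ℕ → ℝ → ℝ≥0∞, (∀ n, Measurable (w n)) →
      (∀ n r, w n r ≤ w (n + 1) r) → (∀ r, ⨆ n, w n r = v r) →
      ∀ (N : ℕ) (L : ℝ) (hL : 0 < L), periodicGroundStateEnergy v N L ≠ ⊤ →
      ∀ δ : ℝ≥0∞, δ ≠ ⊤ → ∀ k : ℕ → ℕ, Tendsto k atTop atTop →
      ∀ Ψ : ℕ → PeriodicTrialState N L,
        (∀ j, periodicEnergy (w (k j)) (Ψ j) ≤ periodicGroundStateEnergy (w (k j)) N L + δ) →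
        ∃ η : Lp ℂ 2 (volume : Measure (UnitAddTorus (Fin N × Fin 3))), ‖η‖ = 1 ∧
          (∀ (σ : Equiv.Perm (Fin N)) (n : Fin N × Fin 3 → ℤ),
            ⟪(mFourierLp 2 (fun p : Fin N × Fin 3 => n (σ p.1, p.2)) :
                Lp ℂ 2 (volume : Measure (UnitAddTorus (Fin N × Fin 3)))), η⟫_ℂ =
              ⟪(mFourierLp 2 n : Lp ℂ 2 (volume : Measure (UnitAddTorus (Fin N × Fin 3)))), η⟫_ℂ) ∧
          (∑' n : Fin N × Fin 3 → ℤ, ENNReal.ofReal (∑ p, (2 * Real.pi * (n p : ℝ) / L) ^ 2) *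
              (‖⟪(mFourierLp 2 n : Lp ℂ 2 (volume : Measure (UnitAddTorus (Fin N × Fin 3)))), η⟫_ℂ‖₊ :
                ℝ≥0∞) ^ 2 +
            ∫⁻ t, periodicInteraction v L (fromUnitTorusN L t) *
              (‖(η : UnitAddTorus (Fin N × Fin 3) → ℂ) t‖₊ : ℝ≥0∞) ^ 2 ≤
            periodicGroundStateEnergy v N L + δ) ∧
          ∃ φ : ℕ → ℕ, StrictMono φ ∧
            Tendsto (fun j => formEmbed hL measurable_zeroProfile (lintegral_periodicInteraction_zero_ne_top N L)
              ⟨graphEmbed hL measurable_zeroProfile (lintegral_periodicInteraction_zero_ne_top N L)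
                ⟨(Ψ (φ j)).ψ, (Ψ (φ j)).mem_periodicCore⟩,
                graphEmbed_mem_formDomain hL measurable_zeroProfile
                  (lintegral_periodicInteraction_zero_ne_top N L) _⟩) atTop (𝓝 η) := by
  intro v _hv w hwm hstep hsup N L hL hE δ hδ k hk Ψ hΨ
  have hmono : ∀ r, Monotone fun n => w n r := fun r => monotone_nat_of_le_succ fun n => hstep n r
  exact exists_limitProfile_of_energy_le hwm hmono hsup hL (ENNReal.add_ne_top.2 ⟨hE, hδ⟩) hk Ψ fun j =>
    (hΨ j).trans (add_le_add_left
      (Summit.AtomisticToContinuum.BoseEinsteinCondensation.Cruxes.PeriodicIRBound.LinearPhFloorWagner.periodicGroundStateEnergy_family_le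
        hmono hsup (k j) N L) δ)

end Summit.AtomisticToContinuum.BoseEinsteinCondensation.Cruxes.HardCoreExtension.NearMinTower

end
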